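import Summits.RiemannHypothesis.RiemannHypothesis.Theorems.WeilColumnThetaTailNorms
import Summits.RiemannHypothesis.RiemannHypothesis.Theorems.WeilColumnTailMellinDecay
import HarnessLib

/-!
# The truncation error `E_R = G₀·(1 − ψ_R)` has transform `‖Ê_R(s)‖ ≤ W_R/‖s − ½‖` with `W_R = C·e^{−(m−1)R}/(m−1)` (PR input)

WEIL column (LADDER-RH, W-P(P2); tier-1 `ThetaCertificateSound`, item PR of THETA-ASSIGN v1.0 §3 = WEIL-THEORY-R3 v1.3 §3⁗).
`E_R` is handoff-prove-2's tail `expProfile Θ·(1 − χ)` (`WeilColumnThetaTailNorms`, p419549) with the CUT REPLACED BY THE SMOOTH STEP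
`ψ` (`ψ ∈ [0,1]`, `ψ = 1` on `[−R, ∞)`, `|ψ′| ≤ Lψ`), so their envelope lemmas `norm_tail_le` / `hasDerivAt_tail` / `norm_deriv_tail_le`
apply verbatim with `(χ, x₁) := (ψ, x₁)` on `x ≤ −R ≤ x₁`; feeding the envelopes (rate `m + ½`, weakened to `m − ½` on `x ≤ 0`) to
`norm_weilMellin_le_of_exp_decay` (p422267) gives, for `Re s ≥ 0`, `s ≠ ½`, `m ≥ 2`:
**`‖weilMellin E_R s‖ ≤ (C·e^{−(m−1)R}/(m−1))/‖s − ½‖`, `C = (3/2 + Lψ)·M/u₁^m + M₁/u₁^{m−1}`** — exponentially small in `R`.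
Hypotheses = the lane's shape: D1 `‖Θ u‖ ≤ M(u/u₁)^m`, D2 `‖u·Θ′(u)‖ ≤ M₁(u/u₁)^{m−1}` on `(0, u₁]`, `u₁ = e^{x₁}`. RH-free; nothing here bears on RH.
-/

set_option linter.dupNamespace false

noncomputable section

open MeasureTheory Set Complex Filter
open scoped Real Topology
open Literature.NumberTheory.LFunctions
open Summit.RiemannHypothesis.RiemannHypothesis.Theorems.WeilColumn.ThetaTail

namespace Summit.RiemannHypothesis.RiemannHypothesis.Theorems.WeilColumn.ThetaMellin

variable {Θ Θ' : ℝ → ℂ} {ψ ψ' : ℝ → ℝ} {M M₁ Lψ u₁ x₁ R : ℝ} {m : ℕ}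

/-- `e^{x/2}(eˣ/u₁)^m ≤ u₁^{−m}·e^{(m − ½)x}` for `x ≤ 0` (drop one factor `eˣ ≤ 1`). [folklore] -/
theorem exp_half_mul_pow_le (hu₁ : 0 < u₁) {x : ℝ} (hx : x ≤ 0) (m : ℕ) :
    Real.exp (x / 2) * (Real.exp x / u₁) ^ m ≤ (u₁ ^ m)⁻¹ * Real.exp (((m : ℝ) - 1 / 2) * x) := by
  have e1 : Real.exp (x / 2) * Real.exp x ^ m = Real.exp (((m : ℝ) + 1 / 2) * x) := by
    rw [← Real.exp_nat_mul, ← Real.exp_add]; ring_nf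
  rw [div_pow, show Real.exp (x / 2) * (Real.exp x ^ m / u₁ ^ m) = (u₁ ^ m)⁻¹ * (Real.exp (x / 2) * Real.exp x ^ m) by ring, e1]
  refine mul_le_mul_of_nonneg_left (Real.exp_le_exp.mpr ?_) (by positivity)
  nlinarith

/-- `e^{x/2}(eˣ/u₁)^{m−1} = u₁^{−(m−1)}·e^{(m − ½)x}` for `1 ≤ m`. [folklore] -/
theorem exp_half_mul_pow_pred_eq (u₁ : ℝ) (hm : 1 ≤ m) (x : ℝ) :
    Real.exp (x / 2) * (Real.exp x / u₁) ^ (m - 1) = (u₁ ^ (m - 1))⁻¹ * Real.exp (((m : ℝ) - 1 / 2) * x) := by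
  have e1 : Real.exp (x / 2) * Real.exp x ^ (m - 1) = Real.exp (((m : ℝ) - 1 / 2) * x) := by
    rw [← Real.exp_nat_mul, ← Real.exp_add]
    congr 1
    rw [Nat.cast_sub hm]; push_cast; ring
  rw [div_pow, show Real.exp (x / 2) * (Real.exp x ^ (m - 1) / u₁ ^ (m - 1)) =
    (u₁ ^ (m - 1))⁻¹ * (Real.exp (x / 2) * Real.exp x ^ (m - 1)) by ring, e1]

/-- **THE TRUNCATION ERROR IS EXPONENTIALLY SMALL AT THE ZEROS.** With `E := expProfile Θ·(1 − ψ)` (`ψ ∈ [0,1]`, `ψ = 1` on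
`[−R, ∞)`, `HasDerivAt ψ (ψ′ x) x`, `|ψ′| ≤ Lψ`), D1/D2 majorants on `(0, u₁]`, `u₁ = e^{x₁}`, `−R ≤ x₁`, `0 ≤ R`, `2 ≤ m`,
`Θ′` continuous on `(0,∞)`, `ψ′` continuous: for every `s` with `0 ≤ Re s`, `s ≠ ½`,
`‖weilMellin E s‖ ≤ (C·e^{−(m−1)R}/(m−1)) / ‖s − ½‖`, `C = ((3/2 + Lψ)·M)/u₁^m + M₁/u₁^{m−1}`. [this seat, PR] -/
theorem norm_weilMellin_truncError_le (hm : 2 ≤ m) (hu₁ : u₁ = Real.exp x₁) (hR : 0 ≤ R) (hRx : -R ≤ x₁) (hx₁0 : x₁ ≤ 0)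
    (hΘ' : ∀ u : ℝ, 0 < u → HasDerivAt Θ (Θ' u) u) (hΘ'c : ContinuousOn Θ' (Ioi 0))
    (hM : ∀ u ∈ Ioc (0 : ℝ) u₁, ‖Θ u‖ ≤ M * (u / u₁) ^ m)
    (hM₁ : ∀ u ∈ Ioc (0 : ℝ) u₁, ‖(u : ℂ) * Θ' u‖ ≤ M₁ * (u / u₁) ^ (m - 1))
    (hM0 : 0 ≤ M) (hM₁0 : 0 ≤ M₁)
    (hψ01 : ∀ x, ψ x ∈ Icc (0 : ℝ) 1) (hψ1 : ∀ x, -R ≤ x → ψ x = 1) (hψ' : ∀ x, HasDerivAt ψ (ψ' x) x)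
    (hψ'c : Continuous ψ') (hL : ∀ x, |ψ' x| ≤ Lψ) (hL0 : 0 ≤ Lψ)
    {s : ℂ} (hs0 : 0 ≤ s.re) (hs : s ≠ 1 / 2) :
    ‖weilMellin (fun x : ℝ => expProfile Θ x * (((1 - ψ x : ℝ)) : ℂ)) s‖ ≤
      ((((3 / 2 + Lψ) * M) / u₁ ^ m + M₁ / u₁ ^ (m - 1)) * Real.exp ((((m : ℝ) - 1 / 2) - 1 / 2) * (-R)) /
          (((m : ℝ) - 1 / 2) - 1 / 2)) / ‖s - 1 / 2‖ := by
  have hm1 : 1 ≤ m := le_trans (by norm_num) hm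
  have hu₁pos : 0 < u₁ := by rw [hu₁]; exact Real.exp_pos _
  set C : ℝ := ((3 / 2 + Lψ) * M) / u₁ ^ m + M₁ / u₁ ^ (m - 1) with hC
  set κ : ℝ := (m : ℝ) - 1 / 2 with hκ
  have hκ' : 1 / 2 < κ := by
    have : (2 : ℝ) ≤ m := by exact_mod_cast hm
    rw [hκ]; linarith
  have hCnn : 0 ≤ C := by positivity
  -- E and its derivative (handoff-prove-2's tail lemmas with the cut := ψ)
  set E : ℝ → ℂ := fun x => expProfile Θ x * (((1 - ψ x : ℝ)) : ℂ) with hE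
  set E' : ℝ → ℂ := fun x => (Real.exp (x / 2) : ℂ) * ((1 / 2 : ℂ) * Θ (Real.exp x) + (Real.exp x : ℂ) * Θ' (Real.exp x)) *
      (((1 - ψ x : ℝ)) : ℂ) - (Real.exp (x / 2) : ℂ) * Θ (Real.exp x) * (ψ' x : ℂ) with hE'
  have hderiv : ∀ x, HasDerivAt E (E' x) x := fun x => hasDerivAt_tail hΘ' hψ' x
  -- continuity of E'
  have hΘc : ContinuousOn Θ (Ioi 0) := fun u hu => (hΘ' u hu).continuousAt.continuousWithinAt
  have hcexp : ∀ {F : ℝ → ℂ}, ContinuousOn F (Ioi 0) → Continuous fun x : ℝ => F (Real.exp x) := fun hF =>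
    hF.comp_continuous Real.continuous_exp fun x => Real.exp_pos x
  have hE'c : Continuous E' := by
    have h1 : Continuous fun x : ℝ => (Real.exp (x / 2) : ℂ) := by fun_prop
    have h2 := hcexp hΘc
    have h3 := hcexp hΘ'c
    have h4 : Continuous fun x : ℝ => (((1 - ψ x : ℝ)) : ℂ) := by
      have hψc : Continuous ψ := continuous_iff_continuousAt.mpr fun x => (hψ' x).continuousAt
      fun_prop
    have h5 : Continuous fun x : ℝ => (ψ' x : ℂ) := by fun_prop
    have h6 : Continuous fun x : ℝ => (Real.exp x : ℂ) := by fun_prop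
    exact ((h1.mul ((continuous_const.mul h2).add (h6.mul h3))).mul h4).sub ((h1.mul h2).mul h5)
  -- E = 0 on [−R, ∞)
  have hzero : ∀ x, -R ≤ x → E x = 0 := fun x hx => tail_eq_zero (Θ := Θ) hψ1 hx
  -- the two exponential envelopes on (−∞, −R]
  have h0 : ∀ x, x ≤ -R → ‖E x‖ ≤ C * Real.exp (κ * x) := by
    intro x hx
    have hx₁ : x ≤ x₁ := hx.trans hRx
    have hx0 : x ≤ 0 := hx₁.trans hx₁0
    refine (norm_tail_le hu₁ hM hψ01 hx₁).trans ?_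
    have h := exp_half_mul_pow_le hu₁pos hx0 m
    calc M * Real.exp (x / 2) * (Real.exp x / u₁) ^ m = M * (Real.exp (x / 2) * (Real.exp x / u₁) ^ m) := by ring
      _ ≤ M * ((u₁ ^ m)⁻¹ * Real.exp (κ * x)) := mul_le_mul_of_nonneg_left h hM0
      _ ≤ C * Real.exp (κ * x) := by
          have key : C * Real.exp (κ * x) - M * ((u₁ ^ m)⁻¹ * Real.exp (κ * x))
              = ((1 / 2 + Lψ) * M / u₁ ^ m + M₁ / u₁ ^ (m - 1)) * Real.exp (κ * x) := by rw [hC]; ring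
          have hnn : 0 ≤ ((1 / 2 + Lψ) * M / u₁ ^ m + M₁ / u₁ ^ (m - 1)) * Real.exp (κ * x) := by positivity
          linarith
  have h1 : ∀ x, x ≤ -R → ‖E' x‖ ≤ C * Real.exp (κ * x) := by
    intro x hx
    have hx₁ : x ≤ x₁ := hx.trans hRx
    have hx0 : x ≤ 0 := hx₁.trans hx₁0
    refine (norm_deriv_tail_le hu₁ hM hM₁ hψ01 hL hx₁).trans ?_
    have ha := exp_half_mul_pow_le hu₁pos hx0 m
    have hb := exp_half_mul_pow_pred_eq u₁ hm1 x
    have hLM : 0 ≤ (1 / 2 + Lψ) * M := by positivity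
    calc (1 / 2 + Lψ) * M * Real.exp (x / 2) * (Real.exp x / u₁) ^ m + M₁ * Real.exp (x / 2) * (Real.exp x / u₁) ^ (m - 1)
        = (1 / 2 + Lψ) * M * (Real.exp (x / 2) * (Real.exp x / u₁) ^ m)
            + M₁ * (Real.exp (x / 2) * (Real.exp x / u₁) ^ (m - 1)) := by ring
      _ ≤ (1 / 2 + Lψ) * M * ((u₁ ^ m)⁻¹ * Real.exp (κ * x)) + M₁ * ((u₁ ^ (m - 1))⁻¹ * Real.exp (κ * x)) := by
          rw [hb]; gcongr
      _ ≤ C * Real.exp (κ * x) := by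
          have key2 : C * Real.exp (κ * x)
              - ((1 / 2 + Lψ) * M * ((u₁ ^ m)⁻¹ * Real.exp (κ * x)) + M₁ * ((u₁ ^ (m - 1))⁻¹ * Real.exp (κ * x)))
              = M / u₁ ^ m * Real.exp (κ * x) := by rw [hC]; ring
          have hnn : 0 ≤ M / u₁ ^ m * Real.exp (κ * x) := by positivity
          linarith
  -- apply the decay lemma with b = −R
  have hb : -R ≤ 0 := by linarith
  have hmain := norm_weilMellin_le_of_exp_decay hderiv hE'c hκ' hCnn hb hzero h0 h1 hs0 hs
  simpa [hκ, hC] using hmain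

end Summit.RiemannHypothesis.RiemannHypothesis.Theorems.WeilColumn.ThetaMellin
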